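import Mathlib
import HarnessLib
import Summits.HubbardSuperconductivity.HubbardSuperconductivity.Theorems.KLProgrammeC4aAbsBubbleFoldSheet
import Summits.HubbardSuperconductivity.HubbardSuperconductivity.Theorems.KLProgrammeC4aAbsBubbleRelative

/-!
# Route `KLProgramme` — crux C4a, S3 brick (B4)/(B5) «(B4)-DIRECT-PACK», part 5: the absolute bubble AWAY FROM THE COOPER WINDOW is `n`-free on the
# WHOLE loop circle with NO located datum — the relative second-order dichotomy of the partner band holds at every loop angle of every non-Cooper configuration

Cell `gate-hubbard-kl`, seat hubbard-kl-k3c3-p3 (g27; row «implicit-function / monotonicity route for μ(n)»).  Located brick for the (C)-closer lane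
hubbard-kl-c4a-1 (stub (C) `stub_twoLeg_curvature` of `KLRegimeEngineV17F2`, stmt-HubbardSuperconductivity-20437), memo HOME/hubbard-kl-k3c3-p3/B4-DIRECT-PACK.md §5.

THE POINT.  Parts 1–4 left the closer one located task: choosing loop pieces (transversal pieces avoiding the caustics, fold windows around them).  It is not
needed.  At a loop angle `x` with `|ē − e| ≤ κ` AND `|∂ₓē| < c₁`, the sheet dichotomy (part 1, at the partner's own chart point) says: either the configuration is
`(c₁,κ)`-Cooper relative to the partner's sheet `m` — excluded for `m ≠ 0` by the umklapp margin (part 2) and for `m = 0` by the hypothesis `s₀ < ‖S‖` defining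
«non-Cooper» — or `‖S − 2πm − 2Φ(0,x+θ)‖ ≤ δ_T := msD₁τ(c₁,κ) + (2hi+κ)/(Dt−2A)`, i.e. `x` ITSELF is a reference angle of a fold window of the sheet `m`, and part 4's
curvature floor at `x₀ := x` gives `∂ₓ²ē ≥ 2w·u_min² − L(δ_T, hi, 0) ≥ w·u_min²` once `L(δ_T, hi, 0) ≤ w·u_min²` (ONE smallness inequality on `(c₁, κ, hi)`):
* §1 signs of the row constants; the generic curvature CEILING `|∂ₓ²ē| ≤ K₂msD₁² + K₁msD₂` (chain rule);
* §2 **`rel_dichotomy_two_partnerBand`**: `|ē − e| ≤ κ → |∂ₓē| < c₁ → w·u_min² ≤ ∂ₓ²ē` at EVERY loop angle, for every configuration not `(c₁,κ)`-Cooper relative to any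
  sheet, every level `0 < e ≤ hi` of the tube;
* §3 **`level_loop_partnerBand_le_nonCooper`** (ASSEMBLED via `…C4aAbsBubbleRelative.level_loop_inv_envelope_le_of_rel_dichotomy_two`, ANY loop piece `[a,b]`, e.g. the
  whole circle): `∫_{lo..hi} w(e)·(∫_{[a,b]} dx/max(t e,|ē|)) de ≤ W·((4(b−a)/κ + 8N/c₁)(κ/2) + 2(12N/√(w·u_min²))√(κ/2) + (b−a)·log⁺(hi/(κ/2)))` with
  `(b−a)·4K₁msD₁ ≤ Nκ`, `(b−a)·4(K₂msD₁² + K₁msD₂) ≤ Nc₁` — CONFIGURATION-FREE and `lo`-FREE.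
Together with part 3 §3 (the Cooper window `‖S‖ ≤ s_C`, keyed on the chord, whole circle) this covers EVERY configuration once `(c₁,κ)` are chosen with
`msD₁τ(c₁,κ) + κ/(Dt−2A) < s_C`: the absolute co-moving bubble is `n`-free in `L¹(dϑ)` uniformly in `(ρ,θ)` with NO piece selection (B4-DIRECT-COUNT §2, B4-ABS-BUBBLE §3
rows (r1)–(r4) all discharged).  Nothing about the model's sizes beyond clause (i) of `FrameOK`; nothing asserts (C), K3 or superconductivity.
References: Salmhofer 1999 §4.5.3 Lemma 4.10 / Cor. 4.11 [cite: Salmhofer1999]; FST II CPAM 51 (1998) §3 [cite: FeldmanSalmhoferTrubowitz1998];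
BGM 2003 §7.1 Lemma 7.1 [cite: BenfattoGiulianiMastropietro2003].
-/

noncomputable section

namespace Summit.HubbardSuperconductivity.HubbardSuperconductivity.Theorems.C4a

set_option linter.dupNamespace false -- summit = problem name (single-conjunct summit), D-0017

open Real Set MeasureTheory
open Literature.MathematicalPhysics.QuantumLattice Literature.MathematicalPhysics.QuantumLattice.BandSectorCounting
open Literature.MathematicalPhysics.QuantumLattice.FermiRG
open Summit.HubbardSuperconductivity.HubbardSuperconductivity.Theorems.KLRegimeSplit
open Summit.HubbardSuperconductivity.HubbardSuperconductivity.Theorems.DispersionFlow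
open Summit.HubbardSuperconductivity.HubbardSuperconductivity.Theorems.PerturbedFermiCurve

/-! ## §1 Signs of the row constants; the generic curvature ceiling -/

/-- `radialRowOneConst A d − 1/d ≥ 0` for `A ≥ 0`, `d > 0`. -/
theorem radialRowOneConst_sub_inv_nonneg {A d : ℝ} (hA : 0 ≤ A) (hd : 0 < d) : 0 ≤ radialRowOneConst A d - 1 / d := by
  have e : radialRowOneConst A d - 1 / d =
      ((4 + 2 * (π * Real.sqrt 2) + 2 * A + 4 * A * (π * Real.sqrt 2)) / d + (4 + 2 * A) * (π * Real.sqrt 2) * (2 + 4 * A) / d ^ 2) / d := by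
    unfold radialRowOneConst; ring
  rw [e]; positivity

/-- `radialRowOneConst A d ≥ 0` for `A ≥ 0`, `d > 0`. -/
theorem radialRowOneConst_nonneg {A d : ℝ} (hA : 0 ≤ A) (hd : 0 < d) : 0 ≤ radialRowOneConst A d := by
  have := radialRowOneConst_sub_inv_nonneg hA hd
  have : 0 ≤ 1 / d := by positivity
  linarith

/-- `uRowTwoConst A A₃ d ≥ 0` for `A, A₃ ≥ 0`, `d > 0`. -/
theorem uRowTwoConst_nonneg {A A₃ d : ℝ} (hA : 0 ≤ A) (hA₃ : 0 ≤ A₃) (hd : 0 < d) : 0 ≤ uRowTwoConst A A₃ d := by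
  have h1 := radialRowOneConst_sub_inv_nonneg hA hd
  have := klCurveR1_nonneg
  have := klCurveR2_nonneg
  unfold uRowTwoConst
  positivity

/-- `msD A₃ A₄ 2 = klCurveD2 > 0`. -/
theorem msD_two_pos (A₃ A₄ : ℝ) : 0 < msD A₃ A₄ 2 := by
  show 0 < klCurveD2
  unfold klCurveD2
  have := klCurveR1_nonneg
  have := klCurveR2_nonneg
  positivity

section Sizes

variable {K : TrigPolyC4v} {A : ℝ} (hA : ∀ p : Momentum, ∀ j ≤ 2, ‖iteratedFDeriv ℝ j (frameShift K) p‖ ≤ A) (hA20 : A ≤ 1 / 20)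
  (hd : klCurveD ≤ (bandBounds (show (-4 : ℝ) < -1.1 by norm_num) (show (-1.1 : ℝ) ≤ -0.1 by norm_num)
    (show (-0.1 : ℝ) < 0 by norm_num)).Dtmin - 2 * A)
  {μ r : ℝ} (hr : 0 < r) (hlo : (-1.1 : ℝ) < μ - r - A) (hhi : μ + r + A < -0.1)
  {A₃ A₄ : ℝ} (hA₃ : ∀ p : Momentum, ‖iteratedFDeriv ℝ 3 (frameShift K) p‖ ≤ A₃)
  (hA₄ : ∀ p : Momentum, ‖iteratedFDeriv ℝ 4 (frameShift K) p‖ ≤ A₄)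
  {K₁ K₂ K₃ : ℝ} (hK₁ : ∀ p : Momentum, ‖fderiv ℝ (frameLevel μ K) p‖ ≤ K₁) (hK₂ : ∀ p : Momentum, ‖iteratedFDeriv ℝ 2 (frameLevel μ K) p‖ ≤ K₂)
  (hK₃ : ∀ p : Momentum, ‖iteratedFDeriv ℝ 3 (frameLevel μ K) p‖ ≤ K₃)
include hA hA20 hd hr hlo hhi hA₃ hA₄ hK₁ hK₂ hK₃

omit hr hK₃ in
/-- **Generic curvature ceiling**: `|∂ₓ² e_K(S − Φ(e,x+θ))| ≤ K₂·msD₁² + K₁·msD₂` (chain rule `∂ₓ² = D²e_K[Γ′,Γ′] − De_K[Γ″]`). -/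
theorem abs_iteratedDeriv_two_partnerBand_pp_angle_le (S : Momentum) {e : ℝ} (he : |e| < r) (θ x : ℝ) :
    |iteratedDeriv 2 (fun y : ℝ => frameLevel μ K (S - levelPoint μ K e (y + θ))) x| ≤ K₂ * msD A₃ A₄ 1 ^ 2 + K₁ * msD A₃ A₄ 2 := by
  rw [iteratedDeriv_two_comp_const_sub_shift (EngineV8.contDiff_frameLevel μ K) (contDiff_levelPoint_of_sizes hA hd hlo hhi he 4) S θ x]
  set p : Momentum := S - levelPoint μ K e (x + θ) with hp
  set v₁ : Momentum := iteratedDeriv 1 (levelPoint μ K e) (x + θ) with hv₁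
  set v₂ : Momentum := iteratedDeriv 2 (levelPoint μ K e) (x + θ) with hv₂
  have hD1 : ‖v₁‖ ≤ msD A₃ A₄ 1 := norm_iteratedDeriv_levelPoint_le hA hA20 hd hlo hhi hA₃ hA₄ he le_rfl (by norm_num) _
  have hD2 : ‖v₂‖ ≤ msD A₃ A₄ 2 := norm_iteratedDeriv_levelPoint_le hA hA20 hd hlo hhi hA₃ hA₄ he (i := 2) (by norm_num) (by norm_num) _
  have hK₁0 : 0 ≤ K₁ := (norm_nonneg _).trans (hK₁ 0)
  have hK₂0 : 0 ≤ K₂ := (norm_nonneg _).trans (hK₂ 0)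
  have h1 : |fderiv ℝ (fderiv ℝ (frameLevel μ K)) p v₁ v₁| ≤ K₂ * msD A₃ A₄ 1 ^ 2 := by
    rw [← Real.norm_eq_abs]
    have h2 : ‖fderiv ℝ (fderiv ℝ (frameLevel μ K)) p‖ ≤ K₂ := by rw [norm_fderiv_two_eq_norm_iteratedFDeriv]; exact hK₂ _
    have hv := norm_nonneg v₁
    have hM0 : 0 ≤ msD A₃ A₄ 1 := hv.trans hD1
    calc _ ≤ ‖fderiv ℝ (fderiv ℝ (frameLevel μ K)) p‖ * ‖v₁‖ * ‖v₁‖ := ContinuousLinearMap.le_opNorm₂ _ _ _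
      _ ≤ K₂ * msD A₃ A₄ 1 * msD A₃ A₄ 1 := mul_le_mul (mul_le_mul h2 hD1 hv hK₂0) hD1 hv (mul_nonneg hK₂0 hM0)
      _ = K₂ * msD A₃ A₄ 1 ^ 2 := by ring
  have h2 : |fderiv ℝ (frameLevel μ K) p v₂| ≤ K₁ * msD A₃ A₄ 2 := by
    rw [← Real.norm_eq_abs]
    exact (ContinuousLinearMap.le_opNorm _ _).trans (mul_le_mul (hK₁ _) hD2 (norm_nonneg _) hK₁0)
  have := abs_sub (fderiv ℝ (fderiv ℝ (frameLevel μ K)) p v₁ v₁) (fderiv ℝ (frameLevel μ K) p v₂)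
  linarith

/-! ## §2 The relative second-order dichotomy of the partner band at EVERY loop angle of a non-Cooper configuration -/

omit hr in
/-- **THE RELATIVE SECOND-ORDER DICHOTOMY, POINTWISE, NO LOCATED DATUM.**  `GeomConstants (frameLevel μ K) Kc r₀ g₀ w`; configuration `(ρ,ϑ,θ)` with pair sum `S`
not `(c₁,κ)`-Cooper relative to any sheet (`hC`: `msD₁τ(c₁,κ) + κ/(Dt−2A) < ‖S − 2πm‖` for all `m`; part 2 discharges `m ≠ 0`); loop level `0 < e ≤ hi` with
`hi < r₀`, `hi + κ < r`; the smallness `hsmall`: p623173's modulus at (`δ_T = msD₁τ(c₁,κ) + (2hi+κ)/(Dt−2A)`, `hi`, offset `0`) is `≤ w·u_min²`.  THEN at every loop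
angle `x`: `|ē − e| ≤ κ → |∂ₓē| < c₁ → w·u_min² ≤ ∂ₓ²ē`. [cite: FeldmanSalmhoferTrubowitz1998, §3; Salmhofer1999, §4.5.3 Lemma 4.10] -/
theorem rel_dichotomy_two_partnerBand {Kc r₀ g₀ w : ℝ} (hG : GeomConstants (frameLevel μ K) Kc r₀ g₀ w) {ρ ϑ θ e hi κ c₁ : ℝ}
    (he0 : 0 < e) (hehi : e ≤ hi) (hhir₀ : hi < r₀) (hhir : hi + κ < r) (hκ : 0 ≤ κ)
    (hC : ∀ m : Fin 2 → ℤ, msD A₃ A₄ 1 *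
            ((π / 2 * c₁ /
                  (((bandBounds (show (-4 : ℝ) < -1.1 by norm_num) (show (-1.1 : ℝ) ≤ -0.1 by norm_num) (show (-0.1 : ℝ) < 0 by norm_num)).Dtmin -
                      2 * A) *
                    (bandBounds (show (-4 : ℝ) < -1.1 by norm_num) (show (-1.1 : ℝ) ≤ -0.1 by norm_num) (show (-0.1 : ℝ) < 0 by norm_num)).umin) +
                π * Kc * κ / ((bandBounds (show (-4 : ℝ) < -1.1 by norm_num) (show (-1.1 : ℝ) ≤ -0.1 by norm_num)
                  (show (-0.1 : ℝ) < 0 by norm_num)).Dtmin - 2 * A) ^ 2) /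
              ((bandBounds (show (-4 : ℝ) < -1.1 by norm_num) (show (-1.1 : ℝ) ≤ -0.1 by norm_num) (show (-0.1 : ℝ) < 0 by norm_num)).umin * w /
                (4 + 2 * A))) +
          κ / ((bandBounds (show (-4 : ℝ) < -1.1 by norm_num) (show (-1.1 : ℝ) ≤ -0.1 by norm_num) (show (-0.1 : ℝ) < 0 by norm_num)).Dtmin - 2 * A) <
        ‖pairSumPath μ K ρ ϑ θ 0 - WithLp.toLp 2 (fun i => 2 * π * (m i : ℝ))‖)
    (hsmall :
        K₃ * ((msD A₃ A₄ 1 *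
            ((π / 2 * c₁ /
                  (((bandBounds (show (-4 : ℝ) < -1.1 by norm_num) (show (-1.1 : ℝ) ≤ -0.1 by norm_num) (show (-0.1 : ℝ) < 0 by norm_num)).Dtmin -
                      2 * A) *
                    (bandBounds (show (-4 : ℝ) < -1.1 by norm_num) (show (-1.1 : ℝ) ≤ -0.1 by norm_num) (show (-0.1 : ℝ) < 0 by norm_num)).umin) +
                π * Kc * κ / ((bandBounds (show (-4 : ℝ) < -1.1 by norm_num) (show (-1.1 : ℝ) ≤ -0.1 by norm_num)
                  (show (-0.1 : ℝ) < 0 by norm_num)).Dtmin - 2 * A) ^ 2) /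
              ((bandBounds (show (-4 : ℝ) < -1.1 by norm_num) (show (-1.1 : ℝ) ≤ -0.1 by norm_num) (show (-0.1 : ℝ) < 0 by norm_num)).umin * w /
                (4 + 2 * A)))) +
          (2 * hi + κ) / ((bandBounds (show (-4 : ℝ) < -1.1 by norm_num) (show (-1.1 : ℝ) ≤ -0.1 by norm_num) (show (-0.1 : ℝ) < 0 by norm_num)).Dtmin - 2 * A) +
              hi / ((bandBounds (show (-4 : ℝ) < -1.1 by norm_num) (show (-1.1 : ℝ) ≤ -0.1 by norm_num) (show (-0.1 : ℝ) < 0 by norm_num)).Dtmin - 2 * A)) *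
            msD A₃ A₄ 1 ^ 2 +
          K₂ * (radialRowOneConst A ((bandBounds (show (-4 : ℝ) < -1.1 by norm_num) (show (-1.1 : ℝ) ≤ -0.1 by norm_num) (show (-0.1 : ℝ) < 0 by norm_num)).Dtmin -
                2 * A) * hi) * (msD A₃ A₄ 1 + msD A₃ A₄ 1) +
          K₂ * ((msD A₃ A₄ 1 *
            ((π / 2 * c₁ /
                  (((bandBounds (show (-4 : ℝ) < -1.1 by norm_num) (show (-1.1 : ℝ) ≤ -0.1 by norm_num) (show (-0.1 : ℝ) < 0 by norm_num)).Dtmin -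
                      2 * A) *
                    (bandBounds (show (-4 : ℝ) < -1.1 by norm_num) (show (-1.1 : ℝ) ≤ -0.1 by norm_num) (show (-0.1 : ℝ) < 0 by norm_num)).umin) +
                π * Kc * κ / ((bandBounds (show (-4 : ℝ) < -1.1 by norm_num) (show (-1.1 : ℝ) ≤ -0.1 by norm_num)
                  (show (-0.1 : ℝ) < 0 by norm_num)).Dtmin - 2 * A) ^ 2) /
              ((bandBounds (show (-4 : ℝ) < -1.1 by norm_num) (show (-1.1 : ℝ) ≤ -0.1 by norm_num) (show (-0.1 : ℝ) < 0 by norm_num)).umin * w /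
                (4 + 2 * A)))) +
          (2 * hi + κ) / ((bandBounds (show (-4 : ℝ) < -1.1 by norm_num) (show (-1.1 : ℝ) ≤ -0.1 by norm_num) (show (-0.1 : ℝ) < 0 by norm_num)).Dtmin - 2 * A) +
              hi / ((bandBounds (show (-4 : ℝ) < -1.1 by norm_num) (show (-1.1 : ℝ) ≤ -0.1 by norm_num) (show (-0.1 : ℝ) < 0 by norm_num)).Dtmin - 2 * A)) *
            msD A₃ A₄ 2 +
          K₁ * ((uRowTwoConst A A₃ ((bandBounds (show (-4 : ℝ) < -1.1 by norm_num) (show (-1.1 : ℝ) ≤ -0.1 by norm_num) (show (-0.1 : ℝ) < 0 by norm_num)).Dtmin -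
                  2 * A) +
                1 / ((bandBounds (show (-4 : ℝ) < -1.1 by norm_num) (show (-1.1 : ℝ) ≤ -0.1 by norm_num) (show (-0.1 : ℝ) < 0 by norm_num)).Dtmin - 2 * A) +
                2 * (radialRowOneConst A ((bandBounds (show (-4 : ℝ) < -1.1 by norm_num) (show (-1.1 : ℝ) ≤ -0.1 by norm_num)
                    (show (-0.1 : ℝ) < 0 by norm_num)).Dtmin - 2 * A) -
                  1 / ((bandBounds (show (-4 : ℝ) < -1.1 by norm_num) (show (-1.1 : ℝ) ≤ -0.1 by norm_num) (show (-0.1 : ℝ) < 0 by norm_num)).Dtmin - 2 * A))) *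
              hi) ≤
        w * (bandBounds (show (-4 : ℝ) < -1.1 by norm_num) (show (-1.1 : ℝ) ≤ -0.1 by norm_num) (show (-0.1 : ℝ) < 0 by norm_num)).umin ^ 2)
    (x : ℝ) (hGe : |frameLevel μ K (pairSumPath μ K ρ ϑ θ 0 - levelPoint μ K e (x + θ)) - e| ≤ κ)
    (hslope : |deriv (fun y : ℝ => frameLevel μ K (pairSumPath μ K ρ ϑ θ 0 - levelPoint μ K e (y + θ))) x| < c₁) :
    w * (bandBounds (show (-4 : ℝ) < -1.1 by norm_num) (show (-1.1 : ℝ) ≤ -0.1 by norm_num) (show (-0.1 : ℝ) < 0 by norm_num)).umin ^ 2 ≤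
      iteratedDeriv 2 (fun y : ℝ => frameLevel μ K (pairSumPath μ K ρ ϑ θ 0 - levelPoint μ K e (y + θ))) x := by
  set B := bandBounds (show (-4 : ℝ) < -1.1 by norm_num) (show (-1.1 : ℝ) ≤ -0.1 by norm_num) (show (-0.1 : ℝ) < 0 by norm_num) with hBdef
  have hr' : 0 < r := by linarith [hκ]
  have her : |e| < r := by rw [abs_of_pos he0]; linarith
  have her₀ : |e| < r₀ := by rw [abs_of_pos he0]; linarith
  have hē : |frameLevel μ K (pairSumPath μ K ρ ϑ θ 0 - levelPoint μ K e (x + θ))| < r := by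
    have h1 := abs_le.1 hGe
    rw [abs_lt]; constructor <;> nlinarith [abs_of_pos he0]
  -- signs
  have hA0 : 0 ≤ A := (norm_nonneg _).trans (hA 0 0 (by norm_num))
  have hA₃0 : 0 ≤ A₃ := (norm_nonneg _).trans (hA₃ 0)
  have hDt : 0 < B.Dtmin - 2 * A := by have := klCurveD_pos; linarith
  have hu : 0 < B.umin := B.umin_pos
  have hw : 0 < w := hG.wmin_pos
  have hcK : 0 < B.umin * w / (4 + 2 * A) := by positivity
  have hKc : 0 ≤ Kc := le_trans (norm_nonneg _) (hG.norm_iteratedFDeriv_le (0 : Momentum) 0 (by norm_num))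
  have hM : 0 ≤ msD A₃ A₄ 1 := (norm_nonneg _).trans (norm_iteratedDeriv_levelPoint_le hA hA20 hd hlo hhi hA₃ hA₄ her le_rfl (by norm_num) 0)
  have hM2 : 0 ≤ msD A₃ A₄ 2 := (norm_nonneg _).trans (norm_iteratedDeriv_levelPoint_le hA hA20 hd hlo hhi hA₃ hA₄ her (i := 2) (by norm_num) (by norm_num) 0)
  have hK₁0 : 0 ≤ K₁ := (norm_nonneg _).trans (hK₁ 0)
  have hK₂0 : 0 ≤ K₂ := (norm_nonneg _).trans (hK₂ 0)
  have hK₃0 : 0 ≤ K₃ := (norm_nonneg _).trans (hK₃ 0)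
  have hRR : 0 ≤ radialRowOneConst A (B.Dtmin - 2 * A) := radialRowOneConst_nonneg hA0 hDt
  have hC2 : 0 ≤ uRowTwoConst A A₃ (B.Dtmin - 2 * A) + 1 / (B.Dtmin - 2 * A) + 2 * (radialRowOneConst A (B.Dtmin - 2 * A) - 1 / (B.Dtmin - 2 * A)) := by
    have := uRowTwoConst_nonneg hA0 hA₃0 hDt
    have := radialRowOneConst_sub_inv_nonneg hA0 hDt
    positivity
  -- the partner is a chart point on some sheet `m`
  obtain ⟨m, ψ, hP⟩ := exists_partner_pp_eq_levelPoint_add_period hA hd hlo hhi (ρ := ρ) (e := e) (ϑ := ϑ) (θ := θ) (φ := x) hē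
  have hv : ∀ q : Momentum, frameLevel μ K (q + WithLp.toLp 2 (fun i => 2 * π * (m i : ℝ))) = frameLevel μ K q := frameLevel_add_twoPi μ K m
  -- the slope `ℓ` at the partner's own chart point is `< c₁`, the level gap `≤ κ`
  have hℓ : |fderiv ℝ (frameLevel μ K) (levelPoint μ K (frameLevel μ K (pairSumPath μ K ρ ϑ θ 0 - levelPoint μ K e (x + θ))) ψ) (iteratedDeriv 1 (levelPoint μ K e) (x + θ))| < c₁ := by
    have h := deriv_partnerBand_pp_angle_eq_neg_sheet hA hd hlo hhi hv her hP
    rw [h, abs_neg] at hslope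
    exact hslope
  have heps : |frameLevel μ K (pairSumPath μ K ρ ϑ θ 0 - levelPoint μ K e (x + θ)) - e| ≤ κ := hGe
  set τ0 := (π / 2 * c₁ / ((B.Dtmin - 2 * A) * B.umin) + π * Kc * κ / (B.Dtmin - 2 * A) ^ 2) / (B.umin * w / (4 + 2 * A)) with hτ0
  have hτ : msD A₃ A₄ 1 *
        ((π / 2 * |fderiv ℝ (frameLevel μ K) (levelPoint μ K (frameLevel μ K (pairSumPath μ K ρ ϑ θ 0 - levelPoint μ K e (x + θ))) ψ) (iteratedDeriv 1 (levelPoint μ K e) (x + θ))| /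
              ((B.Dtmin - 2 * A) * B.umin) + π * Kc * |frameLevel μ K (pairSumPath μ K ρ ϑ θ 0 - levelPoint μ K e (x + θ)) - e| / (B.Dtmin - 2 * A) ^ 2) / (B.umin * w / (4 + 2 * A))) ≤ msD A₃ A₄ 1 * τ0 := by
    refine mul_le_mul_of_nonneg_left (div_le_div_of_nonneg_right (add_le_add ?_ ?_) hcK.le) hM
    · exact div_le_div_of_nonneg_right (mul_le_mul_of_nonneg_left hℓ.le (by positivity)) (by positivity)
    · exact div_le_div_of_nonneg_right (mul_le_mul_of_nonneg_left heps (by positivity)) (by positivity)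
  rcases loopAlignment_dichotomy_sheet hA hA20 hd hlo hhi hA₃ hA₄ hG her hē her₀ hP with h | h
  · -- Cooper relative to the sheet `m`: excluded by `hC m`
    exfalso
    have hee' : |e - frameLevel μ K (pairSumPath μ K ρ ϑ θ 0 - levelPoint μ K e (x + θ))| ≤ κ := by rw [abs_sub_comm]; exact heps
    have h2 : |e - frameLevel μ K (pairSumPath μ K ρ ϑ θ 0 - levelPoint μ K e (x + θ))| / (B.Dtmin - 2 * A) ≤ κ / (B.Dtmin - 2 * A) := div_le_div_of_nonneg_right hee' hDt.le
    have h3 := hC m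
    linarith
  · -- near the caustic of the sheet `m`: the loop angle `x` is its own fold reference
    have hdist : ‖pairSumPath μ K ρ ϑ θ 0 - WithLp.toLp 2 (fun i => 2 * π * (m i : ℝ)) - (levelPoint μ K 0 (x + θ) + levelPoint μ K 0 (x + θ))‖ ≤
        msD A₃ A₄ 1 * τ0 + (2 * hi + κ) / (B.Dtmin - 2 * A) := by
      rw [← two_smul ℝ (levelPoint μ K 0 (x + θ))]
      have hsum : (|e| + |frameLevel μ K (pairSumPath μ K ρ ϑ θ 0 - levelPoint μ K e (x + θ))|) / (B.Dtmin - 2 * A) ≤ (2 * hi + κ) / (B.Dtmin - 2 * A) := by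
        refine div_le_div_of_nonneg_right ?_ hDt.le
        have h1 : |frameLevel μ K (pairSumPath μ K ρ ϑ θ 0 - levelPoint μ K e (x + θ))| ≤ |frameLevel μ K (pairSumPath μ K ρ ϑ θ 0 - levelPoint μ K e (x + θ)) - e| + |e| := by
          have := abs_add_le (frameLevel μ K (pairSumPath μ K ρ ϑ θ 0 - levelPoint μ K e (x + θ)) - e) e
          rwa [sub_add_cancel] at this
        rw [abs_of_pos he0] at h1 ⊢
        linarith
      linarith
    have hfloor := iteratedDeriv_two_partnerBand_pp_angle_ge_sheet hA hA20 hd hr' hlo hhi hA₃ hA₄ hK₁ hK₂ hK₃ hG (pairSumPath μ K ρ ϑ θ 0) m her θ x x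
    rw [sub_self, abs_zero, mul_zero, mul_zero, mul_zero, add_zero, add_zero, add_zero] at hfloor
    -- monotonicity of the modulus in the caustic distance and the level
    have hehi' : |e| ≤ hi := by rw [abs_of_pos he0]; exact hehi
    set δ := msD A₃ A₄ 1 * τ0 + (2 * hi + κ) / (B.Dtmin - 2 * A) with hδ
    set dist := ‖pairSumPath μ K ρ ϑ θ 0 - WithLp.toLp 2 (fun i => 2 * π * (m i : ℝ)) - (levelPoint μ K 0 (x + θ) + levelPoint μ K 0 (x + θ))‖ with hdistdef
    have hq : dist + |e| / (B.Dtmin - 2 * A) ≤ δ + hi / (B.Dtmin - 2 * A) :=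
      add_le_add hdist (div_le_div_of_nonneg_right hehi' hDt.le)
    have t1 : K₃ * (dist + |e| / (B.Dtmin - 2 * A)) * msD A₃ A₄ 1 ^ 2 ≤ K₃ * (δ + hi / (B.Dtmin - 2 * A)) * msD A₃ A₄ 1 ^ 2 :=
      mul_le_mul_of_nonneg_right (mul_le_mul_of_nonneg_left hq hK₃0) (sq_nonneg _)
    have t2 : K₂ * (radialRowOneConst A (B.Dtmin - 2 * A) * |e|) * (msD A₃ A₄ 1 + msD A₃ A₄ 1) ≤
        K₂ * (radialRowOneConst A (B.Dtmin - 2 * A) * hi) * (msD A₃ A₄ 1 + msD A₃ A₄ 1) :=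
      mul_le_mul_of_nonneg_right (mul_le_mul_of_nonneg_left (mul_le_mul_of_nonneg_left hehi' hRR) hK₂0) (by positivity)
    have t3 : K₂ * (dist + |e| / (B.Dtmin - 2 * A)) * msD A₃ A₄ 2 ≤ K₂ * (δ + hi / (B.Dtmin - 2 * A)) * msD A₃ A₄ 2 :=
      mul_le_mul_of_nonneg_right (mul_le_mul_of_nonneg_left hq hK₂0) hM2
    have t4 : K₁ * ((uRowTwoConst A A₃ (B.Dtmin - 2 * A) + 1 / (B.Dtmin - 2 * A) +
          2 * (radialRowOneConst A (B.Dtmin - 2 * A) - 1 / (B.Dtmin - 2 * A))) * |e|) ≤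
        K₁ * ((uRowTwoConst A A₃ (B.Dtmin - 2 * A) + 1 / (B.Dtmin - 2 * A) +
          2 * (radialRowOneConst A (B.Dtmin - 2 * A) - 1 / (B.Dtmin - 2 * A))) * hi) :=
      mul_le_mul_of_nonneg_left (mul_le_mul_of_nonneg_left hehi' hC2) hK₁0
    linarith


/-! ## §3 NON-COOPER CONFIGURATIONS, ASSEMBLED: the absolute bubble on the whole loop circle -/

omit hr in
/-- **THE ABSOLUTE BUBBLE AT A NON-COOPER CONFIGURATION IS `n`-FREE ON THE WHOLE LOOP CIRCLE, NO LOCATED DATUM** (partner band, FrameOK-only constants).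
Configuration `(ρ,ϑ,θ)` not `(c₁,κ)`-Cooper relative to any sheet (`hC`; part 2 discharges `m ≠ 0`, `m = 0` reads `msD₁τ(c₁,κ) + κ/(Dt−2A) < ‖S‖`); loop piece
`[a,b]` ARBITRARY (e.g. the whole circle); levels `e ∈ [lo,hi]`, `0 < lo ≤ hi`, `hi < r₀`, `hi + κ < r`; the smallness `hsmall` of §2 (one inequality on
`(c₁, κ, hi)`); cells `(b−a)·4K₁msD₁ ≤ Nκ`, `(b−a)·4(K₂msD₁² + K₁msD₂) ≤ Nc₁`; floors `t e ≥ e`, weight `0 ≤ w ≤ W`.  THEN, with `c₂ = w·u_min²`,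
`∫_{lo..hi} w(e)·(∫_{[a,b]} dx/max(t e, |e_K(S − Φ(e,x+θ))|)) de ≤ W·((4(b−a)/κ + 8N/c₁)(κ/2) + 2(12N/√c₂)√(κ/2) + (b−a)·log⁺(hi/(κ/2)))` —
CONFIGURATION-FREE and `lo`-FREE. [cite: Salmhofer1999, §4.5.3 Lemma 4.10; FeldmanSalmhoferTrubowitz1998, §3] -/
theorem level_loop_partnerBand_le_nonCooper {Kc r₀ g₀ w : ℝ} (hG : GeomConstants (frameLevel μ K) Kc r₀ g₀ w) (hK₁0 : 0 < K₁)
    {ρ ϑ θ a b lo hi κ c₁ W : ℝ} {t wt : ℝ → ℝ} {N : ℕ}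
    (hab : a ≤ b) (hlo0 : 0 < lo) (hlohi : lo ≤ hi) (hhir₀ : hi < r₀) (hhir : hi + κ < r) (hκ : 0 < κ) (hc₁ : 0 < c₁)
    (hC : ∀ m : Fin 2 → ℤ, msD A₃ A₄ 1 *
            ((π / 2 * c₁ /
                  (((bandBounds (show (-4 : ℝ) < -1.1 by norm_num) (show (-1.1 : ℝ) ≤ -0.1 by norm_num) (show (-0.1 : ℝ) < 0 by norm_num)).Dtmin -
                      2 * A) *
                    (bandBounds (show (-4 : ℝ) < -1.1 by norm_num) (show (-1.1 : ℝ) ≤ -0.1 by norm_num) (show (-0.1 : ℝ) < 0 by norm_num)).umin) +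
                π * Kc * κ / ((bandBounds (show (-4 : ℝ) < -1.1 by norm_num) (show (-1.1 : ℝ) ≤ -0.1 by norm_num) (show (-0.1 : ℝ) < 0 by norm_num)).Dtmin - 2 * A) ^ 2) /
              ((bandBounds (show (-4 : ℝ) < -1.1 by norm_num) (show (-1.1 : ℝ) ≤ -0.1 by norm_num) (show (-0.1 : ℝ) < 0 by norm_num)).umin * w /
                (4 + 2 * A))) +
          κ / ((bandBounds (show (-4 : ℝ) < -1.1 by norm_num) (show (-1.1 : ℝ) ≤ -0.1 by norm_num) (show (-0.1 : ℝ) < 0 by norm_num)).Dtmin - 2 * A) <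
        ‖pairSumPath μ K ρ ϑ θ 0 - WithLp.toLp 2 (fun i => 2 * π * (m i : ℝ))‖)
    (hsmall :
        K₃ * ((msD A₃ A₄ 1 *
            ((π / 2 * c₁ /
                  (((bandBounds (show (-4 : ℝ) < -1.1 by norm_num) (show (-1.1 : ℝ) ≤ -0.1 by norm_num) (show (-0.1 : ℝ) < 0 by norm_num)).Dtmin -
                      2 * A) *
                    (bandBounds (show (-4 : ℝ) < -1.1 by norm_num) (show (-1.1 : ℝ) ≤ -0.1 by norm_num) (show (-0.1 : ℝ) < 0 by norm_num)).umin) +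
                π * Kc * κ / ((bandBounds (show (-4 : ℝ) < -1.1 by norm_num) (show (-1.1 : ℝ) ≤ -0.1 by norm_num) (show (-0.1 : ℝ) < 0 by norm_num)).Dtmin - 2 * A) ^ 2) /
              ((bandBounds (show (-4 : ℝ) < -1.1 by norm_num) (show (-1.1 : ℝ) ≤ -0.1 by norm_num) (show (-0.1 : ℝ) < 0 by norm_num)).umin * w /
                (4 + 2 * A)))) +
          (2 * hi + κ) / ((bandBounds (show (-4 : ℝ) < -1.1 by norm_num) (show (-1.1 : ℝ) ≤ -0.1 by norm_num) (show (-0.1 : ℝ) < 0 by norm_num)).Dtmin - 2 * A) +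
              hi / ((bandBounds (show (-4 : ℝ) < -1.1 by norm_num) (show (-1.1 : ℝ) ≤ -0.1 by norm_num) (show (-0.1 : ℝ) < 0 by norm_num)).Dtmin - 2 * A)) *
            msD A₃ A₄ 1 ^ 2 +
          K₂ * (radialRowOneConst A ((bandBounds (show (-4 : ℝ) < -1.1 by norm_num) (show (-1.1 : ℝ) ≤ -0.1 by norm_num) (show (-0.1 : ℝ) < 0 by norm_num)).Dtmin -
                2 * A) * hi) * (msD A₃ A₄ 1 + msD A₃ A₄ 1) +
          K₂ * ((msD A₃ A₄ 1 *
            ((π / 2 * c₁ /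
                  (((bandBounds (show (-4 : ℝ) < -1.1 by norm_num) (show (-1.1 : ℝ) ≤ -0.1 by norm_num) (show (-0.1 : ℝ) < 0 by norm_num)).Dtmin -
                      2 * A) *
                    (bandBounds (show (-4 : ℝ) < -1.1 by norm_num) (show (-1.1 : ℝ) ≤ -0.1 by norm_num) (show (-0.1 : ℝ) < 0 by norm_num)).umin) +
                π * Kc * κ / ((bandBounds (show (-4 : ℝ) < -1.1 by norm_num) (show (-1.1 : ℝ) ≤ -0.1 by norm_num) (show (-0.1 : ℝ) < 0 by norm_num)).Dtmin - 2 * A) ^ 2) /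
              ((bandBounds (show (-4 : ℝ) < -1.1 by norm_num) (show (-1.1 : ℝ) ≤ -0.1 by norm_num) (show (-0.1 : ℝ) < 0 by norm_num)).umin * w /
                (4 + 2 * A)))) +
          (2 * hi + κ) / ((bandBounds (show (-4 : ℝ) < -1.1 by norm_num) (show (-1.1 : ℝ) ≤ -0.1 by norm_num) (show (-0.1 : ℝ) < 0 by norm_num)).Dtmin - 2 * A) +
              hi / ((bandBounds (show (-4 : ℝ) < -1.1 by norm_num) (show (-1.1 : ℝ) ≤ -0.1 by norm_num) (show (-0.1 : ℝ) < 0 by norm_num)).Dtmin - 2 * A)) *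
            msD A₃ A₄ 2 +
          K₁ * ((uRowTwoConst A A₃ ((bandBounds (show (-4 : ℝ) < -1.1 by norm_num) (show (-1.1 : ℝ) ≤ -0.1 by norm_num) (show (-0.1 : ℝ) < 0 by norm_num)).Dtmin -
                  2 * A) +
                1 / ((bandBounds (show (-4 : ℝ) < -1.1 by norm_num) (show (-1.1 : ℝ) ≤ -0.1 by norm_num) (show (-0.1 : ℝ) < 0 by norm_num)).Dtmin - 2 * A) +
                2 * (radialRowOneConst A ((bandBounds (show (-4 : ℝ) < -1.1 by norm_num) (show (-1.1 : ℝ) ≤ -0.1 by norm_num) (show (-0.1 : ℝ) < 0 by norm_num)).Dtmin - 2 * A) -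
                  1 / ((bandBounds (show (-4 : ℝ) < -1.1 by norm_num) (show (-1.1 : ℝ) ≤ -0.1 by norm_num) (show (-0.1 : ℝ) < 0 by norm_num)).Dtmin - 2 * A))) *
              hi) ≤
        w * (bandBounds (show (-4 : ℝ) < -1.1 by norm_num) (show (-1.1 : ℝ) ≤ -0.1 by norm_num) (show (-0.1 : ℝ) < 0 by norm_num)).umin ^ 2)
    (hN : (b - a) * (4 * (K₁ * msD A₃ A₄ 1)) ≤ N * κ) (hN' : (b - a) * (4 * (K₂ * msD A₃ A₄ 1 ^ 2 + K₁ * msD A₃ A₄ 2)) ≤ N * c₁)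
    (ht : ∀ e ∈ Icc lo hi, e ≤ t e) (hW : 0 ≤ W) (hw0 : ∀ e ∈ Icc lo hi, 0 ≤ wt e) (hw : ∀ e ∈ Icc lo hi, wt e ≤ W) :
    ∫ e in lo..hi, wt e * ∫ x in Icc a b, (max (t e) |frameLevel μ K (pairSumPath μ K ρ ϑ θ 0 - levelPoint μ K e (x + θ))|)⁻¹ ≤
      W * ((4 * (b - a) / κ + 2 * (N * (4 / c₁))) * (κ / 2) +
        2 * (12 * N / Real.sqrt (w * (bandBounds (show (-4 : ℝ) < -1.1 by norm_num) (show (-1.1 : ℝ) ≤ -0.1 by norm_num) (show (-0.1 : ℝ) < 0 by norm_num)).umin ^ 2)) * Real.sqrt (κ / 2) + (b - a) * log⁺ (hi / (κ / 2))) := by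
  have hM := msD_one_pos A₃ A₄
  have hM2 := msD_two_pos A₃ A₄
  have hupos := (bandBounds (show (-4 : ℝ) < -1.1 by norm_num) (show (-1.1 : ℝ) ≤ -0.1 by norm_num) (show (-0.1 : ℝ) < 0 by norm_num)).umin_pos
  have hwpos := hG.wmin_pos
  have hK₂0 : 0 ≤ K₂ := (norm_nonneg _).trans (hK₂ 0)
  have hc₂ : 0 < w * (bandBounds (show (-4 : ℝ) < -1.1 by norm_num) (show (-1.1 : ℝ) ≤ -0.1 by norm_num) (show (-0.1 : ℝ) < 0 by norm_num)).umin ^ 2 := by positivity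
  have hL₂ : 0 < K₂ * msD A₃ A₄ 1 ^ 2 + K₁ * msD A₃ A₄ 2 := by positivity
  have heI : ∀ e ∈ Icc lo hi, |e| < r ∧ 0 < e := fun e he => by
    have h0 : 0 < e := hlo0.trans_le he.1
    rw [abs_of_pos h0]
    exact ⟨by linarith [he.2, hκ], h0⟩
  refine level_loop_inv_envelope_le_of_rel_dichotomy_two (G := fun e x => frameLevel μ K (pairSumPath μ K ρ ϑ θ 0 - levelPoint μ K e (x + θ)))
    hab hlo0 hlohi (fun e he => contDiff_partnerBand_pp_angle hA hd hlo hhi ρ (heI e he).1 ϑ θ 2) hκ hc₁ hc₂ (mul_pos hK₁0 hM) hL₂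
    (fun e he x _ => abs_deriv_partnerBand_pp_angle_le hA hA20 hd hlo hhi hA₃ hA₄ hK₁ ρ (heI e he).1 ϑ θ x)
    (fun e he x _ => abs_iteratedDeriv_two_partnerBand_pp_angle_le hA hA20 hd hlo hhi hA₃ hA₄ hK₁ hK₂ (pairSumPath μ K ρ ϑ θ 0) (heI e he).1 θ x)
    (fun e he x _ hGe hsl => ?_) hN hN' ht hW hw0 hw
  have h := rel_dichotomy_two_partnerBand hA hA20 hd hlo hhi hA₃ hA₄ hK₁ hK₂ hK₃ hG (heI e he).2 he.2 hhir₀ hhir hκ.le hC hsmall x hGe hsl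
  exact h.trans (le_abs_self _)

end Sizes

end Summit.HubbardSuperconductivity.HubbardSuperconductivity.Theorems.C4a

end
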